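import Summits.QuantumFields.YangMills.Theorems.WeakCouplingRatesRung
import Summits.QuantumFields.GaugeBoot.ClassBLimitSiteRP
import Summits.QuantumFields.GaugeBoot.ClassBLimitSymmetry
import HarnessLib

/-!
# Route `SteinGapBootstrap`, crux K2 `GapGivesClusteringG` (stmt-QuantumFields-22999) — part 1/2: the time-zero RP form of a
# torus-limit state in the route's currency (θ-invariance, symmetry, quadratic expansion, shift rule)

HONEST FRAMING. Helper file for the RECORD-label rung R2xi-G (`WeakCouplingRates.XiPow`, an UPPER bound on the lattice mass gap); the
Yang–Mills mass gap is NOT proved by anything here, and no summit statement is touched. Part 2 (`SteinGapBootstrapGapGivesClusteringGCSNonneg`)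
carries the core theorem and the full description of the line «Cauchy–Schwarz split».

WHAT IS PROVED (all `sorry`-free, [folklore] throughout).
* §1 Currency glue: the route's site time-reflection `timeReflectLG` IS GaugeBoot's `configSiteReflect 0` (definitionally); every
  torus-limit state is `θ`-invariant on bounded continuous cylinder observables (`integral_comp_timeReflectLG_of_mem_limitPoints`, from
  the torus theorem `integral_comp_negReflect_eq` — every side `L`, every real `β`).
* §2 Positive-time observables (`IsPosTimeObs`) are stable under future time shifts and under `F + c·H`.
* §3 The time-zero RP form `B₀(F,H) = ∫ F(θU) H(U) dμ − ∫F∘θ dμ ∫H dμ` (written out, no new definition): quadratic expansion along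
  `F + c·H`, SYMMETRY for torus-limit states (θ-invariance), and the SHIFT RULE `Cov_μ(A∘θ, B∘α_{s+s'}) = B₀(A∘α_s, B∘α_{s'})`
  (translation invariance, tree `integral_comp_configShift_of_mem_limitPoints`, `timeShiftLG_timeReflectLG`).

References: K. Osterwalder, E. Seiler, Ann. Phys. 110 (1978) 440, §2; E. Seiler, LNP 159 (1982) Ch. 2.
-/

set_option autoImplicit false

noncomputable section

open MeasureTheory Filter Topology
open Literature.MathematicalPhysics
open Literature.MathematicalPhysics.QuantumFieldTheory hiding ZdEdge Site
open Literature.MathematicalPhysics.QuantumLattice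
open Summit.QuantumFields.YangMills.Theorems.WeakCouplingRates
open Summit.QuantumFields.GaugeBoot

namespace Summit.QuantumFields.YangMills.Theorems.SteinGapBootstrapK2CS

section Currency

variable {d N : ℕ} [NeZero d] {G : Type*} [Group G] [TopologicalSpace G] [IsTopologicalGroup G] [CompactSpace G]
  [MeasurableSpace G] [BorelSpace G]

/-! ### §1 Currency glue: `timeReflectLG = configSiteReflect 0`; θ-invariance of torus-limit states -/

omit [TopologicalSpace G] [IsTopologicalGroup G] [CompactSpace G] [MeasurableSpace G] [BorelSpace G] in
/-- The route's site time-reflection is GaugeBoot's axis-`0` site reflection (definitionally). -/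
theorem timeReflectLG_eq_configSiteReflect (U : LGConfig d G) :
    timeReflectLG U = configSiteReflect 0 U := rfl

omit [TopologicalSpace G] [IsTopologicalGroup G] [CompactSpace G] [MeasurableSpace G] [BorelSpace G] in
/-- `θ` is an involution. -/
theorem timeReflectLG_timeReflectLG (U : LGConfig d G) : timeReflectLG (timeReflectLG U) = U :=
  configSiteReflect_configSiteReflect 0 U

omit [CompactSpace G] [MeasurableSpace G] [BorelSpace G] in
/-- `θ` is continuous. -/
theorem continuous_timeReflectLG : Continuous (timeReflectLG : LGConfig d G → LGConfig d G) :=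
  continuous_configSiteReflect 0

omit [TopologicalSpace G] [IsTopologicalGroup G] [CompactSpace G] [MeasurableSpace G] [BorelSpace G] in
/-- A cylinder observable read on the reflected field is a cylinder observable (reflected support). -/
theorem isCylinder_timeReflect {α : Type*} {F : LGConfig d G → α} {S : Finset (QuantumLattice.ZdEdge d)}
    (hF : IsCylinder F S) :
    IsCylinder (fun U => F (timeReflectLG U))
      (S.image fun e => if e.2 = (0 : Fin d) then (zdSiteReflect 0 e.1 - Pi.single 0 1, (0 : Fin d))
        else (zdSiteReflect 0 e.1, e.2)) :=
  isCylinder_comp_configSiteReflect hF 0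

variable (ρ : G →* Matrix (Fin N) (Fin N) ℂ)

/-- **θ-invariance of torus-limit states** on bounded continuous cylinder observables (every real `β`, every subsequence of sides):
the periodic lift intertwines `θ` with the torus reflection `negReflect`, under which every torus Wilson state is invariant. -/
theorem integral_comp_timeReflectLG_of_mem_limitPoints (hρ : Continuous ρ) {β : ℝ} {μ : Measure (LGConfig d G)}
    (hμ : μ ∈ infiniteVolumeLimitPoints (d := d) ρ β) {F : LGConfig d G → ℝ} {S : Finset (QuantumLattice.ZdEdge d)}
    (hFS : IsCylinder F S) (hFc : Continuous F) (hFb : ∃ C, ∀ U, |F U| ≤ C) :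
    ∫ U, F (timeReflectLG U) ∂μ = ∫ U, F U ∂μ := by
  obtain ⟨L, _hL, _hprob, hconv⟩ := hμ
  have h1 := hconv (F ∘ configSiteReflect 0) _ (isCylinder_comp_configSiteReflect hFS 0)
    (hFc.comp (continuous_configSiteReflect 0)) (by obtain ⟨C, hC⟩ := hFb; exact ⟨C, fun U => hC _⟩)
  have h2 := hconv F S hFS hFc hFb
  have hE : ∀ k : ℕ, wilsonExpectation (L := L k + 1) ρ β (toTorusObservable (L k + 1) (F ∘ configSiteReflect 0)) =
      wilsonExpectation (L := L k + 1) ρ β (toTorusObservable (L k + 1) F) := fun k => by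
    rw [toTorusObservable_comp_configSiteReflect_zero]
    exact integral_comp_negReflect_eq ρ hρ β _
  simp only [hE] at h1
  exact tendsto_nhds_unique h1 h2

/-! ### §2 Positive-time observables: closure properties -/

omit [Group G] [IsTopologicalGroup G] [CompactSpace G] [BorelSpace G] in
/-- Positive-time observables are stable under time shifts into the future. -/
theorem isPosTimeObs_timeShift {A : LGConfig d G → ℝ} (hA : IsPosTimeObs A) (s : ℕ) :
    IsPosTimeObs (fun U => A (timeShiftLG (G := G) s U)) := by
  obtain ⟨⟨S, hS, hS0⟩, hc, C, hC⟩ := hA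
  refine ⟨⟨_, isCylinder_timeShift hS s, fun e he => ?_⟩, hc.comp (continuous_timeShiftLG s), C, fun U => hC _⟩
  obtain ⟨e', he', rfl⟩ := Finset.mem_image.1 he
  have := hS0 e' he'
  simp only [Pi.add_apply, Pi.single_eq_same]
  omega

omit [Group G] [IsTopologicalGroup G] [CompactSpace G] [MeasurableSpace G] [BorelSpace G] in
/-- Positive-time observables are stable under `F + c·H`. -/
theorem isPosTimeObs_add_mul {F H : LGConfig d G → ℝ} (hF : IsPosTimeObs F) (hH : IsPosTimeObs H) (c : ℝ) :
    IsPosTimeObs (fun U => F U + c * H U) := by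
  classical
  obtain ⟨⟨S, hS, hS0⟩, hFc, CF, hCF⟩ := hF
  obtain ⟨⟨T, hT, hT0⟩, hHc, CH, hCH⟩ := hH
  refine ⟨⟨S ∪ T, ?_, fun e he => ?_⟩, hFc.add (continuous_const.mul hHc), CF + |c| * CH, fun U => ?_⟩
  · intro U V hUV
    have e₁ : F U = F V := hS fun e he => hUV e (by rw [Finset.coe_union]; exact Or.inl he)
    have e₂ : H U = H V := hT fun e he => hUV e (by rw [Finset.coe_union]; exact Or.inr he)
    simp only [e₁, e₂]
  · rcases Finset.mem_union.1 he with he | he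
    exacts [hS0 e he, hT0 e he]
  · calc |F U + c * H U| ≤ |F U| + |c * H U| := abs_add_le _ _
      _ ≤ CF + |c| * CH := by
        rw [abs_mul]
        exact add_le_add (hCF U) (mul_le_mul_of_nonneg_left (hCH U) (abs_nonneg c))

/-! ### §3 The time-zero RP form of a torus-limit state: symmetry, quadratic expansion, shift rule -/

variable [SecondCountableTopology G]

omit [NeZero d] [Group G] [IsTopologicalGroup G] [CompactSpace G] in
/-- Bounded continuous observables are integrable for a finite measure on `ℤ^d` configurations. -/
theorem integrable_of_continuous_bdd (μ : Measure (LGConfig d G)) [IsFiniteMeasure μ] {F : LGConfig d G → ℝ}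
    (hFc : Continuous F) {C : ℝ} (hC : ∀ U, |F U| ≤ C) : Integrable F μ :=
  Integrable.of_bound hFc.measurable.aestronglyMeasurable C (ae_of_all _ fun U => by
    rw [Real.norm_eq_abs]; exact hC U)

omit [CompactSpace G] in
/-- **Quadratic expansion** of the time-zero RP form along `F + c·H`. -/
theorem rpForm_add_mul_expand (μ : Measure (LGConfig d G)) [IsFiniteMeasure μ] {F H : LGConfig d G → ℝ}
    (hFc : Continuous F) (hHc : Continuous H) {CF CH : ℝ} (hCF : ∀ U, |F U| ≤ CF) (hCH : ∀ U, |H U| ≤ CH) (c : ℝ) :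
    (∫ U, (F (timeReflectLG U) + c * H (timeReflectLG U)) * (F U + c * H U) ∂μ) -
        (∫ U, (F (timeReflectLG U) + c * H (timeReflectLG U)) ∂μ) * (∫ U, (F U + c * H U) ∂μ) =
      ((∫ U, F (timeReflectLG U) * F U ∂μ) - (∫ U, F (timeReflectLG U) ∂μ) * (∫ U, F U ∂μ)) +
        c * (((∫ U, F (timeReflectLG U) * H U ∂μ) - (∫ U, F (timeReflectLG U) ∂μ) * (∫ U, H U ∂μ)) +
          ((∫ U, H (timeReflectLG U) * F U ∂μ) - (∫ U, H (timeReflectLG U) ∂μ) * (∫ U, F U ∂μ))) +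
        c ^ 2 * ((∫ U, H (timeReflectLG U) * H U ∂μ) - (∫ U, H (timeReflectLG U) ∂μ) * (∫ U, H U ∂μ)) := by
  have hθc : Continuous (timeReflectLG : LGConfig d G → LGConfig d G) := continuous_timeReflectLG
  have hFθc : Continuous fun U : LGConfig d G => F (timeReflectLG U) := hFc.comp hθc
  have hHθc : Continuous fun U : LGConfig d G => H (timeReflectLG U) := hHc.comp hθc
  have hCF0 : 0 ≤ CF := (abs_nonneg _).trans (hCF (fun _ => 1))
  have hprod : ∀ {X Y : LGConfig d G → ℝ}, Continuous X → Continuous Y → ∀ {CX CY : ℝ}, (∀ U, |X U| ≤ CX) →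
      (∀ U, |Y U| ≤ CY) → Integrable (fun U => X U * Y U) μ := by
    intro X Y hX hY CX CY hCX hCY
    refine integrable_of_continuous_bdd μ (hX.mul hY) (C := CX * CY) fun U => ?_
    rw [abs_mul]
    exact mul_le_mul (hCX U) (hCY U) (abs_nonneg _) ((abs_nonneg _).trans (hCX U))
  have iFF := hprod hFθc hFc (fun U => hCF _) hCF
  have iFH := hprod hFθc hHc (fun U => hCF _) hCH
  have iHF := hprod hHθc hFc (fun U => hCH _) hCF
  have iHH := hprod hHθc hHc (fun U => hCH _) hCH
  have iF := integrable_of_continuous_bdd μ hFc hCF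
  have iH := integrable_of_continuous_bdd μ hHc hCH
  have iFθ := integrable_of_continuous_bdd μ hFθc (fun U => hCF _)
  have iHθ := integrable_of_continuous_bdd μ hHθc (fun U => hCH _)
  have e1 : (∫ U, (F (timeReflectLG U) + c * H (timeReflectLG U)) * (F U + c * H U) ∂μ) =
      (∫ U, F (timeReflectLG U) * F U ∂μ) + c * (∫ U, F (timeReflectLG U) * H U ∂μ) +
        c * (∫ U, H (timeReflectLG U) * F U ∂μ) + c ^ 2 * (∫ U, H (timeReflectLG U) * H U ∂μ) := by
    have hpt : (fun U => (F (timeReflectLG U) + c * H (timeReflectLG U)) * (F U + c * H U)) =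
        fun U => F (timeReflectLG U) * F U + c * (F (timeReflectLG U) * H U) +
          c * (H (timeReflectLG U) * F U) + c ^ 2 * (H (timeReflectLG U) * H U) := by
      funext U; ring
    have i1 : Integrable (fun U => F (timeReflectLG U) * F U + c * (F (timeReflectLG U) * H U)) μ :=
      iFF.add (iFH.const_mul c)
    have i2 : Integrable (fun U => F (timeReflectLG U) * F U + c * (F (timeReflectLG U) * H U) +
        c * (H (timeReflectLG U) * F U)) μ := i1.add (iHF.const_mul c)
    rw [hpt, integral_add i2 (iHH.const_mul _), integral_add i1 (iHF.const_mul c), integral_add iFF (iFH.const_mul c),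
      integral_const_mul, integral_const_mul, integral_const_mul]
  have e2 : (∫ U, (F (timeReflectLG U) + c * H (timeReflectLG U)) ∂μ) =
      (∫ U, F (timeReflectLG U) ∂μ) + c * (∫ U, H (timeReflectLG U) ∂μ) := by
    rw [integral_add iFθ (iHθ.const_mul c), integral_const_mul]
  have e3 : (∫ U, (F U + c * H U) ∂μ) = (∫ U, F U ∂μ) + c * (∫ U, H U ∂μ) := by
    rw [integral_add iF (iH.const_mul c), integral_const_mul]
  rw [e1, e2, e3]
  ring

omit [SecondCountableTopology G] in
/-- **Symmetry of the time-zero RP form** of a torus-limit state on bounded continuous cylinder observables. -/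
theorem rpForm_symm (hρ : Continuous ρ) {β : ℝ} {μ : Measure (LGConfig d G)}
    (hμ : μ ∈ infiniteVolumeLimitPoints (d := d) ρ β) {F H : LGConfig d G → ℝ} {S T : Finset (QuantumLattice.ZdEdge d)}
    (hFS : IsCylinder F S) (hHT : IsCylinder H T) (hFc : Continuous F) (hHc : Continuous H)
    {CF CH : ℝ} (hCF : ∀ U, |F U| ≤ CF) (hCH : ∀ U, |H U| ≤ CH) :
    (∫ U, F (timeReflectLG U) * H U ∂μ) - (∫ U, F (timeReflectLG U) ∂μ) * (∫ U, H U ∂μ) =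
      (∫ U, H (timeReflectLG U) * F U ∂μ) - (∫ U, H (timeReflectLG U) ∂μ) * (∫ U, F U ∂μ) := by
  have hθc : Continuous (timeReflectLG : LGConfig d G → LGConfig d G) := continuous_timeReflectLG
  have hF1 := integral_comp_timeReflectLG_of_mem_limitPoints ρ hρ hμ hFS hFc ⟨CF, hCF⟩
  have hH1 := integral_comp_timeReflectLG_of_mem_limitPoints ρ hρ hμ hHT hHc ⟨CH, hCH⟩
  -- `K U := F (θU) * H U`; `K (θU) = F U * H (θU)`
  have hK := integral_comp_timeReflectLG_of_mem_limitPoints ρ hρ hμ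
    (IsCylinder.mul (isCylinder_timeReflect hFS) hHT) ((hFc.comp hθc).mul hHc)
    ⟨CF * CH, fun U => by
      rw [abs_mul]
      exact mul_le_mul (hCF _) (hCH _) (abs_nonneg _) ((abs_nonneg _).trans (hCF U))⟩
  simp only [timeReflectLG_timeReflectLG] at hK
  have e : (∫ U, H (timeReflectLG U) * F U ∂μ) = ∫ U, F (timeReflectLG U) * H U ∂μ := by
    rw [← hK]
    exact integral_congr_ae (ae_of_all _ fun U => mul_comm _ _)
  rw [hF1, hH1, e]
  ring

omit [SecondCountableTopology G] in
/-- **Shift rule**: `Cov_μ(A∘θ, B∘α_{s+s'}) = B₀(A∘α_s, B∘α_{s'})` for a torus-limit state (translation invariance along the time axis,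
`α_s ∘ θ = θ ∘ shift_{+s}`). -/
theorem cov_eq_rpForm_shift {β : ℝ} {μ : Measure (LGConfig d G)}
    (hμ : μ ∈ infiniteVolumeLimitPoints (d := d) ρ β) {A B : LGConfig d G → ℝ} {S T : Finset (QuantumLattice.ZdEdge d)}
    (hAS : IsCylinder A S) (hBT : IsCylinder B T) (hAc : Continuous A) (hBc : Continuous B)
    {CA CB : ℝ} (hCA : ∀ U, |A U| ≤ CA) (hCB : ∀ U, |B U| ≤ CB) (s s' : ℕ) :
    (∫ U, A (timeReflectLG U) * B (timeShiftLG (G := G) (s + s') U) ∂μ) -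
        (∫ U, A (timeReflectLG U) ∂μ) * (∫ U, B (timeShiftLG (G := G) (s + s') U) ∂μ) =
      (∫ U, A (timeShiftLG (G := G) s (timeReflectLG U)) * B (timeShiftLG (G := G) s' U) ∂μ) -
        (∫ U, A (timeShiftLG (G := G) s (timeReflectLG U)) ∂μ) * (∫ U, B (timeShiftLG (G := G) s' U) ∂μ) := by
  have hθc : Continuous (timeReflectLG : LGConfig d G → LGConfig d G) := continuous_timeReflectLG
  have hCA0 : 0 ≤ CA := (abs_nonneg _).trans (hCA (fun _ => 1))
  -- the product term
  have hIJ : ∀ U, A (timeShiftLG (G := G) s (timeReflectLG U)) * B (timeShiftLG (G := G) s' U) =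
      (fun W => A (timeReflectLG W) * B (timeShiftLG (G := G) (s' + s) W)) (configShift (Pi.single 0 (s : ℤ)) U) := by
    intro U
    show A (timeShiftLG (G := G) s (timeReflectLG U)) * B (timeShiftLG (G := G) s' U) =
      A (timeReflectLG (configShift (Pi.single 0 (s : ℤ)) U)) *
        B (timeShiftLG (G := G) (s' + s) (configShift (Pi.single 0 (s : ℤ)) U))
    rw [timeShiftLG_timeReflectLG, timeShiftLG_add_configShift_single]
  have hJcyl := IsCylinder.mul (isCylinder_timeReflect hAS) (isCylinder_timeShift hBT (s' + s))
  have hJc : Continuous fun W : LGConfig d G => A (timeReflectLG W) * B (timeShiftLG (G := G) (s' + s) W) :=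
    (hAc.comp hθc).mul (hBc.comp (continuous_timeShiftLG (s' + s)))
  have hJb : ∃ C', ∀ W : LGConfig d G, |A (timeReflectLG W) * B (timeShiftLG (G := G) (s' + s) W)| ≤ C' :=
    ⟨CA * CB, fun W => by
      rw [abs_mul]
      exact mul_le_mul (hCA _) (hCB _) (abs_nonneg _) hCA0⟩
  have hJint : ∫ U, (fun W => A (timeReflectLG W) * B (timeShiftLG (G := G) (s' + s) W))
        (configShift (Pi.single 0 (s : ℤ)) U) ∂μ =
      ∫ U, (fun W => A (timeReflectLG W) * B (timeShiftLG (G := G) (s' + s) W)) U ∂μ :=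
    integral_comp_configShift_of_mem_limitPoints ρ hμ _ hJcyl hJc hJb
  have e1 : (∫ U, A (timeShiftLG (G := G) s (timeReflectLG U)) * B (timeShiftLG (G := G) s' U) ∂μ) =
      ∫ U, A (timeReflectLG U) * B (timeShiftLG (G := G) (s' + s) U) ∂μ :=
    (integral_congr_ae (ae_of_all _ hIJ)).trans hJint
  -- the means
  have hAθ : ∀ U, A (timeShiftLG (G := G) s (timeReflectLG U)) =
      (fun W => A (timeReflectLG W)) (configShift (Pi.single 0 (s : ℤ)) U) := fun U => by
    show A (timeShiftLG (G := G) s (timeReflectLG U)) = A (timeReflectLG (configShift (Pi.single 0 (s : ℤ)) U))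
    rw [timeShiftLG_timeReflectLG]
  have hAint : ∫ U, (fun W => A (timeReflectLG W)) (configShift (Pi.single 0 (s : ℤ)) U) ∂μ =
      ∫ U, A (timeReflectLG U) ∂μ :=
    integral_comp_configShift_of_mem_limitPoints ρ hμ _ (isCylinder_timeReflect hAS) (hAc.comp hθc)
      ⟨CA, fun U => hCA _⟩
  have e2 : (∫ U, A (timeShiftLG (G := G) s (timeReflectLG U)) ∂μ) = ∫ U, A (timeReflectLG U) ∂μ :=
    (integral_congr_ae (ae_of_all _ hAθ)).trans hAint
  have hB1 : ∫ U, B (timeShiftLG (G := G) s' U) ∂μ = ∫ U, B U ∂μ :=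
    integral_comp_configShift_of_mem_limitPoints ρ hμ _ hBT hBc ⟨CB, hCB⟩
  have hB2 : ∫ U, B (timeShiftLG (G := G) (s + s') U) ∂μ = ∫ U, B U ∂μ :=
    integral_comp_configShift_of_mem_limitPoints ρ hμ _ hBT hBc ⟨CB, hCB⟩
  rw [e1, e2, hB1, hB2, Nat.add_comm s' s]

end Currency

end Summit.QuantumFields.YangMills.Theorems.SteinGapBootstrapK2CS

end
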